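import Summits.MatrixMultiplication.OmegaCensus.SmallFormats.RankOnePlaneCapGaugeV12
import HarnessLib

/-!
# ω-census family (a): the residual group of the SINGLE-plane gauge — free-block normal form

Cell `pub-omega` (unit `pub-omega-eng1`, gen 33), topic `Summits/MatrixMultiplication/OmegaCensus`
(sub-folder `SmallFormats`). Framing (verbatim): lottery ticket; floor = certified bounds/negative
ranges. HONEST FRAMING: bookkeeping for the gauge-SAT encoders of the `𝔽₃` `⟨2,2,5⟩@17` X-marginal
census, SINGLE saturated column plane (`gauge_normal_form_v12_single`: the `R`-outputs live in
`F′ = ⟨e₀,e₁⟩`, the head of `i₀` is one of 6 forms; 6 cases per orbit, three free output columns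
`2,3,4`). The residual group contains every `A' ∈ GL₅` acting on output rows by `x ↦ x A'` that
FIXES `e₀, e₁` (so every row in `F′`, hence every `R`-output and the head, is unchanged, and the new
Y-forms agree with the old ones on matrices with vanishing columns `2,3,4`, hence columns `0,1` of
every `G_i` and the `θᵀG_i`-zeros are unchanged). Choosing the new basis
`(e₀, e₁, pivot rows of the first term with a row outside F′, …)` gives the

**free-block normal form** (`freeBlock_normal_form`, any field, any `m`, two output rows, terms in a
linear order): EITHER every output row lies in `F′`, OR for the first term `i₁` with an output row
outside `F′` (all earlier terms having both rows in `F′`) one of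
* (F2) `W_{i₁} = [[0,0,1,0,0],[0,0,0,1,0]]` (both rows independent modulo `F′`),
* (F1) `W_{i₁}[0] = (0,0,1,0,0)` and `W_{i₁}[1] = (a,b,c,0,0)`,
* (F1′) `W_{i₁}[0] = (a,b,0,0,0) ∈ F′` and `W_{i₁}[1] = (0,0,1,0,0)`.
With `m` free terms this is `3m + 1` sub-cases per head case; `gauge_normal_form_v12_single_freeBlock`
composes it with the single-plane v1.2 gauge (head at `i₀ ∈ R`). The forms pin entries to `1`; an
encoder that also applies the per-term sign rule (`exists_rescale_gw`) either scans the pivot entry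
first for term `i₁` or uses the sign-invariant reading `≠ 0`. Not a bound on any rank, not progress
on `ω`.
-/

namespace Summit.MatrixMultiplication.OmegaCensus.RankOnePlaneCapGeneral

open Module Matrix Literature.Computability.AlgebraicComplexity

variable {k : Type*} [Field k] {c m : ℕ} {ι : Type*} [Fintype ι]

/-! ### Coordinates in an adapted basis -/

/-- Coordinate matrices of a basis `b` of `k⁵` with their action spelled out: `x ↦ x A'` takes
coordinates (`(x A')_j = (b.repr x)_j`) and `Y ↦ Y A` replaces row `μ` of `Y` by `∑_j Y[μ][j] · b_j`. -/
theorem exists_coordMatrices_repr (b : Basis (Fin 5) k (Fin 5 → k)) :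
    ∃ A A' : Matrix (Fin 5) (Fin 5) k, A * A' = 1 ∧ A' * A = 1 ∧
      (∀ x : Fin 5 → k, ∀ j, (x ᵥ* A') j = b.repr x j) ∧
      (∀ Y : Matrix (Fin m) (Fin 5) k, ∀ μ, (Y * A) μ = ∑ j, Y μ j • b j) := by
  classical
  let e : (Fin 5 → k) ≃ₗ[k] (Fin 5 → k) := b.equivFun
  refine ⟨(LinearMap.toMatrix' (e.symm : (Fin 5 → k) →ₗ[k] (Fin 5 → k)))ᵀ,
    (LinearMap.toMatrix' (e : (Fin 5 → k) →ₗ[k] (Fin 5 → k)))ᵀ, ?_, ?_, ?_, ?_⟩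
  · rw [← Matrix.transpose_mul, ← LinearMap.toMatrix'_comp, LinearEquiv.comp_symm,
      LinearMap.toMatrix'_id, Matrix.transpose_one]
  · rw [← Matrix.transpose_mul, ← LinearMap.toMatrix'_comp, LinearEquiv.symm_comp,
      LinearMap.toMatrix'_id, Matrix.transpose_one]
  · intro x j
    rw [Matrix.vecMul_transpose, LinearMap.toMatrix'_mulVec]
    simp [e]
  · intro Y μ
    have : (Y * (LinearMap.toMatrix' (e.symm : (Fin 5 → k) →ₗ[k] (Fin 5 → k)))ᵀ) μ =
        Y μ ᵥ* (LinearMap.toMatrix' (e.symm : (Fin 5 → k) →ₗ[k] (Fin 5 → k)))ᵀ := rfl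
    rw [this, Matrix.vecMul_transpose, LinearMap.toMatrix'_mulVec]
    simp [e]

/-- Rows in `F′ = ⟨e₀,e₁⟩` have themselves as coordinates in a basis starting with `e₀, e₁`. -/
theorem repr_eq_self_of_inF (b : Basis (Fin 5) k (Fin 5 → k)) (hb0 : b 0 = Pi.single 0 1)
    (hb1 : b 1 = Pi.single 1 1) {x : Fin 5 → k} (h2 : x 2 = 0) (h3 : x 3 = 0) (h4 : x 4 = 0) :
    ∀ j, b.repr x j = x j := by
  have hx : x = x 0 • b 0 + x 1 • b 1 := by
    funext ν; rw [hb0, hb1]; fin_cases ν <;> simp [h2, h3, h4]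
  have hrepr : b.repr x = x 0 • Finsupp.single 0 1 + x 1 • Finsupp.single 1 1 := by
    conv_lhs => rw [hx]
    rw [map_add, map_smul, map_smul, b.repr_self, b.repr_self]
  intro j
  rw [hrepr]
  fin_cases j <;> simp [h2, h3, h4]

/-- **Basis transform fixing `F′`.** For a basis `b` of `k⁵` with `b₀ = e₀`, `b₁ = e₁`, a computation
of `⟨c,m,5⟩` yields one with the SAME X-forms whose output rows are the `b`-coordinates of the old
ones (rows in `F′` unchanged) and whose Y-forms agree with the old ones on every `Y` with vanishing
columns `2,3,4`. -/
theorem exists_basisTransform (β : BilinComp (mulBilin k c m 5) ι) (b : Basis (Fin 5) k (Fin 5 → k))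
    (hb0 : b 0 = Pi.single 0 1) (hb1 : b 1 = Pi.single 1 1) :
    ∃ β' : BilinComp (mulBilin k c m 5) ι,
      (∀ i, β'.f i = β.f i) ∧
      (∀ i (Y : Matrix (Fin m) (Fin 5) k), (∀ μ, Y μ 2 = 0 ∧ Y μ 3 = 0 ∧ Y μ 4 = 0) →
        β'.g i Y = β.g i Y) ∧
      (∀ i κ j, β'.w i κ j = b.repr (β.w i κ) j) ∧
      (∀ i κ, β.w i κ 2 = 0 ∧ β.w i κ 3 = 0 ∧ β.w i κ 4 = 0 → β'.w i κ = β.w i κ) := by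
  obtain ⟨A, A', hAA', -, hcoord, hrow⟩ := exists_coordMatrices_repr (m := m) b
  obtain ⟨β', hf, hg, hw⟩ := exists_colTransform β A A' hAA'
  have hw' : ∀ i κ j, β'.w i κ j = b.repr (β.w i κ) j := fun i κ j => by
    rw [hw]; exact hcoord (β.w i κ) j
  refine ⟨β', hf, fun i Y hY => ?_, hw', fun i κ h => ?_⟩
  · rw [hg]
    congr 1
    ext μ ν
    rw [hrow Y μ]
    obtain ⟨h2, h3, h4⟩ := hY μ
    simp only [Fin.sum_univ_five, h2, h3, h4, zero_smul, add_zero, hb0, hb1]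
    fin_cases ν
    · simp
    · simp
    · simpa using h2.symm
    · simpa using h3.symm
    · simpa using h4.symm
  · funext j
    rw [hw']
    exact repr_eq_self_of_inF b hb0 hb1 h.1 h.2.1 h.2.2 j

/-- `e₁, e₀` are linearly independent in `k⁵`. -/
theorem linearIndependent_e1_e0 :
    LinearIndependent k ![(Pi.single 1 1 : Fin 5 → k), Pi.single 0 1] := by
  rw [LinearIndependent.pair_iff]
  intro s t h
  have h0 := congrFun h 0
  have h1 := congrFun h 1
  simp at h0 h1
  exact ⟨h1, h0⟩

/-- A vector in the span of `e₁, e₀` has vanishing coordinates `2,3,4`. -/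
theorem inF_of_mem_span_e1_e0 {x : Fin 5 → k}
    (hx : x ∈ Submodule.span k (Set.range ![(Pi.single 1 1 : Fin 5 → k), Pi.single 0 1])) :
    x 2 = 0 ∧ x 3 = 0 ∧ x 4 = 0 := by
  obtain ⟨cf, rfl⟩ := (Submodule.mem_span_range_iff_exists_fun k).mp hx
  simp [Fin.sum_univ_two]

/-- The coordinates of a basis vector: `b.repr (b i) = e_i`. -/
theorem repr_basis_eq_single (b : Basis (Fin 5) k (Fin 5 → k)) (i : Fin 5) :
    (fun j => b.repr (b i) j) = Pi.single i 1 := by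
  funext j; rw [b.repr_self, Finsupp.single_eq_pi_single]

/-! ### The free-block normal form -/

/-- **Free-block normal form** (residual group of the single-plane gauge; any field, two output rows,
any `m`, terms in a linear order). See the module doc-string: EITHER all output rows lie in
`F′ = ⟨e₀,e₁⟩`, OR the first term `i₁` with a row outside `F′` is brought to form (F2), (F1) or
(F1′), by a transform keeping the X-forms, every row in `F′`, and the Y-forms on matrices with
vanishing columns `2,3,4`. -/
theorem freeBlock_normal_form [LinearOrder ι] (β : BilinComp (mulBilin k 2 m 5) ι) :
    ∃ β' : BilinComp (mulBilin k 2 m 5) ι,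
      (∀ i, β'.f i = β.f i) ∧
      (∀ i (Y : Matrix (Fin m) (Fin 5) k), (∀ μ, Y μ 2 = 0 ∧ Y μ 3 = 0 ∧ Y μ 4 = 0) →
        β'.g i Y = β.g i Y) ∧
      (∀ i κ, β.w i κ 2 = 0 ∧ β.w i κ 3 = 0 ∧ β.w i κ 4 = 0 → β'.w i κ = β.w i κ) ∧
      ((∀ i κ, β'.w i κ 2 = 0 ∧ β'.w i κ 3 = 0 ∧ β'.w i κ 4 = 0) ∨
        ∃ i₁, (∀ i, i < i₁ → ∀ κ, β'.w i κ 2 = 0 ∧ β'.w i κ 3 = 0 ∧ β'.w i κ 4 = 0) ∧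
          ((β'.w i₁ 0 = Pi.single 2 1 ∧ β'.w i₁ 1 = Pi.single 3 1) ∨
           (β'.w i₁ 0 = Pi.single 2 1 ∧ β'.w i₁ 1 3 = 0 ∧ β'.w i₁ 1 4 = 0) ∨
           ((β'.w i₁ 0 2 = 0 ∧ β'.w i₁ 0 3 = 0 ∧ β'.w i₁ 0 4 = 0) ∧
              β'.w i₁ 1 = Pi.single 2 1))) := by
  classical
  by_cases hall : ∀ i κ, β.w i κ 2 = 0 ∧ β.w i κ 3 = 0 ∧ β.w i κ 4 = 0
  · exact ⟨β, fun _ => rfl, fun _ _ _ => rfl, fun _ _ _ => rfl, Or.inl hall⟩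
  push Not at hall
  -- the first term with a row outside `F′`
  set T : Finset ι := Finset.univ.filter fun i => ∃ κ, ¬(β.w i κ 2 = 0 ∧ β.w i κ 3 = 0 ∧
    β.w i κ 4 = 0) with hTdef
  have hT : T.Nonempty := by
    obtain ⟨i, κ, h⟩ := hall
    exact ⟨i, Finset.mem_filter.mpr ⟨Finset.mem_univ _, κ, fun h' => h h'.1 h'.2.1 h'.2.2⟩⟩
  set i₁ := T.min' hT with hi₁def
  have hi₁T : ∃ κ, ¬(β.w i₁ κ 2 = 0 ∧ β.w i₁ κ 3 = 0 ∧ β.w i₁ κ 4 = 0) :=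
    (Finset.mem_filter.mp (Finset.min'_mem T hT)).2
  have hbefore : ∀ i, i < i₁ → ∀ κ, β.w i κ 2 = 0 ∧ β.w i κ 3 = 0 ∧ β.w i κ 4 = 0 := by
    intro i hi κ
    by_contra h
    have hiT : i ∈ T := Finset.mem_filter.mpr ⟨Finset.mem_univ _, κ, h⟩
    exact absurd hi (not_lt.mpr (Finset.min'_le T i hiT))
  have hcard : Fintype.card (Fin 5) = finrank k (Fin 5 → k) := by simp
  -- common packaging: a basis `(e₀, e₁, b₂, b₃, b₄)` written as `![b₄, b₃, b₂, e₁, e₀]` reversed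
  have key : ∀ (v : Fin 5 → Fin 5 → k), LinearIndependent k v →
      v 3 = Pi.single 1 1 → v 4 = Pi.single 0 1 →
      ∃ (b : Basis (Fin 5) k (Fin 5 → k)) (β' : BilinComp (mulBilin k 2 m 5) ι),
        (∀ i, b i = v (Fin.rev i)) ∧
        (∀ i, β'.f i = β.f i) ∧
        (∀ i (Y : Matrix (Fin m) (Fin 5) k), (∀ μ, Y μ 2 = 0 ∧ Y μ 3 = 0 ∧ Y μ 4 = 0) →
          β'.g i Y = β.g i Y) ∧
        (∀ i κ j, β'.w i κ j = b.repr (β.w i κ) j) ∧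
        (∀ i κ, β.w i κ 2 = 0 ∧ β.w i κ 3 = 0 ∧ β.w i κ 4 = 0 → β'.w i κ = β.w i κ) := by
    intro v hli h3 h4
    let b₀ := basisOfLinearIndependentOfCardEqFinrank hli hcard
    have hb₀ : ⇑b₀ = v := coe_basisOfLinearIndependentOfCardEqFinrank hli hcard
    let b := b₀.reindex Fin.revPerm
    have hb : ∀ i, b i = v (Fin.rev i) := fun i => by
      rw [Basis.reindex_apply, Fin.revPerm_symm, Fin.revPerm_apply, hb₀]
    have hb0 : b 0 = Pi.single 0 1 := by rw [hb]; exact h4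
    have hb1 : b 1 = Pi.single 1 1 := by rw [hb]; exact h3
    obtain ⟨β', hf, hg, hw, hrow⟩ := exists_basisTransform β b hb0 hb1
    exact ⟨b, β', hb, hf, hg, hw, hrow⟩
  have hbefore' : ∀ {β' : BilinComp (mulBilin k 2 m 5) ι},
      (∀ i κ, β.w i κ 2 = 0 ∧ β.w i κ 3 = 0 ∧ β.w i κ 4 = 0 → β'.w i κ = β.w i κ) →
      ∀ i, i < i₁ → ∀ κ, β'.w i κ 2 = 0 ∧ β'.w i κ 3 = 0 ∧ β'.w i κ 4 = 0 := by
    intro β' hrow i hi κ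
    rw [hrow i κ (hbefore i hi κ)]; exact hbefore i hi κ
  -- the pivot rows
  have hli2 := linearIndependent_e1_e0 (k := k)
  by_cases h0 : β.w i₁ 0 2 = 0 ∧ β.w i₁ 0 3 = 0 ∧ β.w i₁ 0 4 = 0
  · -- (F1′): row 0 in `F′`, so row 1 is outside
    have h1 : ¬(β.w i₁ 1 2 = 0 ∧ β.w i₁ 1 3 = 0 ∧ β.w i₁ 1 4 = 0) := by
      obtain ⟨κ, hκ⟩ := hi₁T
      fin_cases κ
      · exact absurd h0 hκ
      · exact hκ
    have hr1 : β.w i₁ 1 ∉ Submodule.span k (Set.range ![(Pi.single 1 1 : Fin 5 → k),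
        Pi.single 0 1]) := fun h => h1 (inF_of_mem_span_e1_e0 h)
    have hli3 : LinearIndependent k ![β.w i₁ 1, Pi.single 1 1, Pi.single 0 1] :=
      LinearIndependent.finCons hli2 hr1
    obtain ⟨x', hx'⟩ := exists_not_mem_span_fin5 (by norm_num) hli3
    have hli4 : LinearIndependent k ![x', β.w i₁ 1, Pi.single 1 1, Pi.single 0 1] :=
      LinearIndependent.finCons hli3 hx'
    obtain ⟨x, hx⟩ := exists_not_mem_span_fin5 (by norm_num) hli4
    have hli5 : LinearIndependent k ![x, x', β.w i₁ 1, Pi.single 1 1, Pi.single 0 1] :=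
      LinearIndependent.finCons hli4 hx
    obtain ⟨b, β', hb, hf, hg, hw, hrow⟩ := key _ hli5 rfl rfl
    have hb2 : b 2 = β.w i₁ 1 := by rw [hb]; rfl
    refine ⟨β', hf, hg, hrow, Or.inr ⟨i₁, hbefore' hrow, Or.inr (Or.inr ⟨?_, ?_⟩)⟩⟩
    · rw [hrow i₁ 0 h0]; exact h0
    · rw [show β'.w i₁ 1 = fun j => b.repr (b 2) j from by funext j; rw [hw, hb2]]
      exact repr_basis_eq_single b 2
  · -- row 0 outside `F′`
    have hr0 : β.w i₁ 0 ∉ Submodule.span k (Set.range ![(Pi.single 1 1 : Fin 5 → k),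
        Pi.single 0 1]) := fun h => h0 (inF_of_mem_span_e1_e0 h)
    have hli3 : LinearIndependent k ![β.w i₁ 0, Pi.single 1 1, Pi.single 0 1] :=
      LinearIndependent.finCons hli2 hr0
    by_cases h1 : β.w i₁ 1 ∈ Submodule.span k (Set.range ![β.w i₁ 0, (Pi.single 1 1 : Fin 5 → k),
        Pi.single 0 1])
    · -- (F1): row 1 depends on `e₀, e₁, row 0`
      obtain ⟨x', hx'⟩ := exists_not_mem_span_fin5 (by norm_num) hli3
      have hli4 : LinearIndependent k ![x', β.w i₁ 0, Pi.single 1 1, Pi.single 0 1] :=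
        LinearIndependent.finCons hli3 hx'
      obtain ⟨x, hx⟩ := exists_not_mem_span_fin5 (by norm_num) hli4
      have hli5 : LinearIndependent k ![x, x', β.w i₁ 0, Pi.single 1 1, Pi.single 0 1] :=
        LinearIndependent.finCons hli4 hx
      obtain ⟨b, β', hb, hf, hg, hw, hrow⟩ := key _ hli5 rfl rfl
      have hb2 : b 2 = β.w i₁ 0 := by rw [hb]; rfl
      have hb1 : b 1 = Pi.single 1 1 := by rw [hb]; rfl
      have hb0 : b 0 = Pi.single 0 1 := by rw [hb]; rfl
      -- coordinates of row 1: only `0,1,2`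
      obtain ⟨cf, hcf⟩ := (Submodule.mem_span_range_iff_exists_fun k).mp h1
      have hrepr1 : b.repr (β.w i₁ 1) = cf 0 • Finsupp.single 2 1 + cf 1 • Finsupp.single 1 1 +
          cf 2 • Finsupp.single 0 1 := by
        rw [← hcf, Fin.sum_univ_three]
        simp only [Matrix.cons_val_zero, Matrix.cons_val_one, Matrix.cons_val_two,
          Matrix.tail_cons, Matrix.head_cons, map_add, map_smul]
        rw [← hb2, ← hb1, ← hb0, b.repr_self, b.repr_self, b.repr_self]
      refine ⟨β', hf, hg, hrow, Or.inr ⟨i₁, hbefore' hrow, Or.inr (Or.inl ⟨?_, ?_, ?_⟩)⟩⟩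
      · rw [show β'.w i₁ 0 = fun j => b.repr (b 2) j from by funext j; rw [hw, hb2]]
        exact repr_basis_eq_single b 2
      · rw [hw, hrepr1]; simp
      · rw [hw, hrepr1]; simp
    · -- (F2): rows 0, 1 independent modulo `F′`
      have hli4 : LinearIndependent k ![β.w i₁ 1, β.w i₁ 0, Pi.single 1 1, Pi.single 0 1] :=
        LinearIndependent.finCons hli3 h1
      obtain ⟨x, hx⟩ := exists_not_mem_span_fin5 (by norm_num) hli4
      have hli5 : LinearIndependent k ![x, β.w i₁ 1, β.w i₁ 0, Pi.single 1 1, Pi.single 0 1] :=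
        LinearIndependent.finCons hli4 hx
      obtain ⟨b, β', hb, hf, hg, hw, hrow⟩ := key _ hli5 rfl rfl
      have hb2 : b 2 = β.w i₁ 0 := by rw [hb]; rfl
      have hb3 : b 3 = β.w i₁ 1 := by rw [hb]; rfl
      refine ⟨β', hf, hg, hrow, Or.inr ⟨i₁, hbefore' hrow, Or.inl ⟨?_, ?_⟩⟩⟩
      · rw [show β'.w i₁ 0 = fun j => b.repr (b 2) j from by funext j; rw [hw, hb2]]
        exact repr_basis_eq_single b 2
      · rw [show β'.w i₁ 1 = fun j => b.repr (b 3) j from by funext j; rw [hw, hb3]]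
        exact repr_basis_eq_single b 3

/-! ### Composition with the single-plane v1.2 gauge (`𝔽₃`, `⟨2,2,5⟩`, 17 products) -/

/-- The `θᵀG_i`-coordinates `0,1` are unchanged by a transform that keeps every `g_i` on matrices
with vanishing columns `2,3,4`. -/
theorem vecMul_gMatrix_eq_of_agree234 {β β' : BilinComp (mulBilin k c m 5) ι}
    (hg : ∀ i (Y : Matrix (Fin m) (Fin 5) k), (∀ μ, Y μ 2 = 0 ∧ Y μ 3 = 0 ∧ Y μ 4 = 0) →
      β'.g i Y = β.g i Y) (θ : Fin m → k) (i : ι) {ν : Fin 5} (h2 : ν ≠ 2) (h3 : ν ≠ 3)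
    (h4 : ν ≠ 4) :
    (θ ᵥ* Matrix.of fun μ ν => β'.g i (Matrix.single μ ν (1 : k))) ν =
      (θ ᵥ* Matrix.of fun μ ν => β.g i (Matrix.single μ ν (1 : k))) ν := by
  simp only [Matrix.vecMul, dotProduct, Matrix.of_apply]
  refine Finset.sum_congr rfl fun μ _ => ?_
  rw [hg i _ fun μ' => ⟨Matrix.single_apply_of_col_ne μ μ' h2 (1 : k),
    Matrix.single_apply_of_col_ne μ μ' h3 (1 : k), Matrix.single_apply_of_col_ne μ μ' h4 (1 : k)⟩]

/-- **The single-plane v1.2 gauge followed by the free-block normal form** (what a census word for a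
single-plane orbit obtained with the free-block split cites). Hypotheses of
`gauge_normal_form_v12_single` with the head at `i₀ ∈ R` and the terms in a linear order;
conclusion: its full normal form (same X-forms, `R`-outputs in `F′ = ⟨e₀,e₁⟩`, `θᵀG_i` zeros in
coordinates `0,1`, head in the 6-element `GL₂` list) AND the free-block disjunction with
`i₁ ∉ R`. -/
theorem gauge_normal_form_v12_single_freeBlock [LinearOrder ι] [DecidableEq ι]
    (h17 : Fintype.card ι = 17) (β : BilinComp (mulBilin (ZMod 3) 2 2 5) ι)
    {lam : Fin 2 → ZMod 3} (hlam : lam ≠ 0) (R : Finset ι)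
    (hR : ∀ i ∈ R, ∀ z : Fin 2 → ZMod 3, β.f i (vecMulVec z lam) = 0) (hc : R.card = 4)
    {i₀ : ι} (hi₀ : i₀ ∈ R) :
    ∃ β' : BilinComp (mulBilin (ZMod 3) 2 2 5) ι,
      (∀ i, β'.f i = β.f i) ∧
      (∀ i ∈ R, ∀ κ, β'.w i κ 2 = 0 ∧ β'.w i κ 3 = 0 ∧ β'.w i κ 4 = 0) ∧
      (∃ θ : Fin 2 → ZMod 3, θ ≠ 0 ∧ θ ⬝ᵥ lam = 0 ∧ ∀ i, i ∉ R →
        (θ ᵥ* Matrix.of fun μ ν => β'.g i (Matrix.single μ ν (1 : ZMod 3))) 0 = 0 ∧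
        (θ ᵥ* Matrix.of fun μ ν => β'.g i (Matrix.single μ ν (1 : ZMod 3))) 1 = 0) ∧
      !![β'.w i₀ 0 0, β'.w i₀ 0 1; β'.w i₀ 1 0, β'.w i₀ 1 1] ∈
        ([!![0, 0; 0, 0], !![1, 0; 0, 0], !![1, 0; 1, 0], !![1, 0; 2, 0], !![0, 0; 1, 0],
          !![1, 0; 0, 1]] : List (Matrix (Fin 2) (Fin 2) (ZMod 3))) ∧
      ((∀ i κ, β'.w i κ 2 = 0 ∧ β'.w i κ 3 = 0 ∧ β'.w i κ 4 = 0) ∨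
        ∃ i₁, i₁ ∉ R ∧ (∀ i, i < i₁ → ∀ κ, β'.w i κ 2 = 0 ∧ β'.w i κ 3 = 0 ∧ β'.w i κ 4 = 0) ∧
          ((β'.w i₁ 0 = Pi.single 2 1 ∧ β'.w i₁ 1 = Pi.single 3 1) ∨
           (β'.w i₁ 0 = Pi.single 2 1 ∧ β'.w i₁ 1 3 = 0 ∧ β'.w i₁ 1 4 = 0) ∨
           ((β'.w i₁ 0 2 = 0 ∧ β'.w i₁ 0 3 = 0 ∧ β'.w i₁ 0 4 = 0) ∧
              β'.w i₁ 1 = Pi.single 2 1))) := by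
  classical
  obtain ⟨β₁, hf₁, hs₁, ⟨θ, hθ, hθlam, hG₁⟩, hhead₁⟩ :=
    gauge_normal_form_v12_single h17 β hlam R hR hc i₀
  obtain ⟨β₂, hf₂, hg₂, hrow, hnf⟩ := freeBlock_normal_form β₁
  have hRrow : ∀ i ∈ R, ∀ κ, β₂.w i κ = β₁.w i κ := fun i hi κ => hrow i κ (hs₁ i hi κ)
  have hG : ∀ (i : ι) (ν : Fin 5), ν ≠ 2 → ν ≠ 3 → ν ≠ 4 →
      (θ ᵥ* Matrix.of fun μ ν => β₂.g i (Matrix.single μ ν (1 : ZMod 3))) ν =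
        (θ ᵥ* Matrix.of fun μ ν => β₁.g i (Matrix.single μ ν (1 : ZMod 3))) ν :=
    fun i ν h2 h3 h4 => vecMul_gMatrix_eq_of_agree234 hg₂ θ i h2 h3 h4
  refine ⟨β₂, fun i => by rw [hf₂, hf₁], fun i hi κ => by rw [hRrow i hi κ]; exact hs₁ i hi κ,
    ⟨θ, hθ, hθlam, fun i hi => ?_⟩, by rw [hRrow i₀ hi₀ 0, hRrow i₀ hi₀ 1]; exact hhead₁, ?_⟩
  · rw [hG i 0 (by decide) (by decide) (by decide), hG i 1 (by decide) (by decide) (by decide)]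
    exact hG₁ i hi
  · rcases hnf with hall | ⟨i₁, hbefore, hforms⟩
    · exact Or.inl hall
    · have hn : i₁ ∉ R := by
        intro h
        have hz := hs₁ i₁ h
        rcases hforms with ⟨h0, -⟩ | ⟨h0, -⟩ | ⟨-, h1⟩
        · have := congrFun h0 2
          rw [hRrow i₁ h 0, (hz 0).1] at this
          exact absurd this (by simp)
        · have := congrFun h0 2
          rw [hRrow i₁ h 0, (hz 0).1] at this
          exact absurd this (by simp)
        · have := congrFun h1 2
          rw [hRrow i₁ h 1, (hz 1).1] at this
          exact absurd this (by simp)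
      exact Or.inr ⟨i₁, hn, hbefore, hforms⟩

end Summit.MatrixMultiplication.OmegaCensus.RankOnePlaneCapGeneral
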